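import Literature.Topology.SummableDiracCombSeparation
import Summits.HodgeConjecture.HodgeConjecture.Theorems.F0P3SeparationRegroup
import HarnessLib

/-!
# The law (L1) «separating by Hecke eigenvalues» DISCHARGED for injective, bounded, `*`-closed tests

Cell `hodgecm-mathlib`, F0∕P3 «U3-mult», crux H413 (`stmt-HodgeConjecture-24833`), RUNG 4 integrator (PLAN.F0P3g4 §24 Z3);
F0P4-p02 (g5) for the F0∕P3 desk.  Helper file, 0 def ∕ 0 sorry, `--supports stmt-HodgeConjecture-24833 --as helper`.

B1 (★ `Theorems/F0P3SeparationRegroup.lean`, F0P3-p03 (g6)) consumes the separation lemma as the HYPOTHESIS SHAPE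
`SeparationLemma E T hat := ∀ α, (∀ fT, Summable (t ↦ α t * hat t fT)) → (∀ fT, Σ' t, α t * hat t fT = 0) → ∀ t, α t = 0`.
★ `Literature/Topology/SummableDiracCombSeparation.lean` PROVES that shape (Stone–Weierstrass on the compact closure of the
packages + Urysohn) whenever `hat` is injective (a package is determined by its eigenvalues — «`ψ_G` is injective on
e.v.p.'s», [Rogawski1990, §13.7 p. 206]), pointwise bounded (`∀ f, ∃ C, ∀ t, ‖hat t f‖ ≤ C` — e.v.p.'s of UNITARY
representations; F0P3-ref1 (g4) R-7: without the bound the shape is false), and the test values are closed under products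
and conjugation and contain `1` (`T` a unital `*`-algebra, each `hat t` a `*`-character).  This file is the one-line
adapter: `separationLemma_of_injective_bounded_starClosed : … → SeparationLemma E T hat`, plus the set-of-characters form.

References: [Rogawski1990] §13.7 p. 206; [Langlands1980] pp. 208–211.  HC_CM is proved only modulo the printed citations
until rung 0 closes.
-/

set_option autoImplicit false
-- project-wide idiom for `Summit.HodgeConjecture.HodgeConjecture.…` (summit = problem name): the namespace IS duplicated
set_option linter.dupNamespace false

noncomputable section

open scoped ComplexConjugate

namespace Summit.HodgeConjecture.HodgeConjecture.Cruxes.H413.F0P3SeparationRegroup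

variable {E T : Type*}

/-- **(L1) discharged — the separation lemma HOLDS for injective, pointwise-bounded, `*`-closed test data.**
If `hat : E → T → ℂ` is injective, `‖hat t f‖ ≤ C_f` uniformly in `t`, and the test values are closed under products and
complex conjugation and contain the constant `1`, then `SeparationLemma E T hat`
(★ `Literature.Topology.separation_of_injective_bounded_starClosed`). [cite: Rogawski1990, §13.7 p. 206]
[cite: Langlands1980, pp. 208–211] -/
theorem separationLemma_of_injective_bounded_starClosed (hat : E → T → ℂ)
    (hinj : Function.Injective hat)
    (hbdd : ∀ f : T, ∃ C : ℝ, ∀ t : E, ‖hat t f‖ ≤ C)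
    (hmul : ∀ f g : T, ∃ h : T, ∀ t : E, hat t h = hat t f * hat t g)
    (hstar : ∀ f : T, ∃ g : T, ∀ t : E, hat t g = conj (hat t f))
    (hone : ∃ u : T, ∀ t : E, hat t u = 1) :
    SeparationLemma E T hat :=
  fun α hsum hzero t =>
    Literature.Topology.separation_of_injective_bounded_starClosed hat hinj hbdd hmul hstar hone α
      hsum hzero t

/-- **(L1) discharged — set-of-characters form.**  For a set `E ⊆ (T → ℂ)` of pointwise bounded functions whose values
are closed under products and conjugation and contain `1` (bounded `*`-characters of a unital `*`-algebra `T`),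
`SeparationLemma E T (fun t f => t f)` holds (★ `Literature.Topology.separation_of_bounded_characters`).
[cite: Rogawski1990, §13.7 p. 206] [cite: Langlands1980, pp. 208–211] -/
theorem separationLemma_of_bounded_characters {E : Set (T → ℂ)}
    (hbdd : ∀ f : T, ∃ C : ℝ, ∀ t ∈ E, ‖t f‖ ≤ C)
    (hmul : ∀ f g : T, ∃ h : T, ∀ t ∈ E, t h = t f * t g)
    (hstar : ∀ f : T, ∃ g : T, ∀ t ∈ E, t g = conj (t f))
    (hone : ∃ u : T, ∀ t ∈ E, t u = 1) :
    SeparationLemma E T (fun (t : E) (f : T) => (t : T → ℂ) f) :=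
  fun α hsum hzero t =>
    Literature.Topology.separation_of_bounded_characters hbdd hmul hstar hone α hsum hzero t

end Summit.HodgeConjecture.HodgeConjecture.Cruxes.H413.F0P3SeparationRegroup

end
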